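import Mathlib
import Summits.ValiantsHypothesis.ValiantsHypothesis.Theorems.FifoMatchingNNLinearDegreeCofactorHardInflateWordRanks
import Summits.ValiantsHypothesis.ValiantsHypothesis.Theorems.FifoMatchingNNMonotoneHardPadRanks
import HarnessLib

/-!
# Crux `NNLinearDegreeCofactorHard` (stmt-ValiantsHypothesis-23918), line `internal_cofactor`, stub S2b (ii):
# the inflated queue word — HEIGHTS and the PAIR WALK (unit (A″), part 3)

For the word `InflateWord.inflateWord R L m y` of `…InflateWordDefs.lean` (SPEC `Lines/internal_cofactor-S2b-SPEC.md`,
design «R ≡ pop with pre-inflation»), with height `h(u) := #openers<u − #closers<u` and envelope `H(u) = L + need u`: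

* `height_eq` — for every `u ≤ N`,
  `h(u) = Σ_{i < min(vrank u, 2jE)} ±[preLetter i] + Σ_{i < vrank u − 2jE} ±[i < tailPushes] − #(R ∩ [0,u))`
  (one induction on `u`: non-defect positions contribute their letters in V-rank order, defects pop);
* `sum_preLetter_eq`, `height_pairStart` — at the `t`-th pair start `u_t = vpos (2t)`, `jA ≤ t ≤ jE`:
  `h(u_t) = 2·jA + Σ_{jA ≤ j < t} (letter sum of pair j) − #(R ∩ [0,u_t))`;
* `headPairs_le`, `headPairs_spec` — S4: `jA ≤ jE`, and `jA` is the least index satisfying the head condition when one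
  exists; `card_inflStarts_eq` — the inflation pair starts in `[u_a, u_b)` are the pairs `a ≤ j < b` with `isInflate j`;
* `height_sub_need_pairStart` — **the pair walk identity** (what unit (E″) consumes):
  `(h − need)(u_t) − (h − need)(u_A) = Σ_{jA ≤ j < t} (letter sum_j − [isInflate j])`, i.e. `h − H` sampled at pair
  starts is, up to the head overshoot `h(u_A) − H(u_A)`, the walk of the CENTRED pair steps of
  `…PairWalkBand.card_filter_pairWalk_exits_le`.

Balance and the ballot property (for unit (F″)) follow in `…InflateWordBallot.lean`.  Honest framing: bookkeeping for ONE
unit of an OPEN stub's measure construction; nothing here proves S2b, the crux, `NNDivisionHard`, `NNNotVP` or VP ≠ VNP.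
No definitions, no named facts.
-/

noncomputable section

-- Sub = Summit single-conjunct layout: the duplicated namespace component is mandated by the tree.
set_option linter.dupNamespace false

namespace Summit.ValiantsHypothesis.ValiantsHypothesis.Theorems.FifoMatching.NNLinearDegreeCofactorHard.InflateWord

open Finset Literature.Computability.AlgebraicComplexity
open Summit.ValiantsHypothesis.ValiantsHypothesis.Theorems.FifoMatching.NNMonotoneHard

variable {N : ℕ} (R : Finset (Fin N)) (L m : ℕ) (y : Fin (2 * (Rᶜ.card / 2)) → Bool)

/-! ### Ranks below `0` -/

/-- No element of `s` is below position `0`. [folklore] -/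
theorem card_filter_lt_zero {M : ℕ} (s : Finset (Fin M)) : (s.filter fun i => i.val < 0).card = 0 := by
  rw [card_eq_zero, filter_eq_empty_iff]
  intro i _ h
  exact Nat.not_lt_zero _ h

/-! ### The height of the inflated word -/

/-- **The height formula.**  For every `u ≤ N`, the height `#openers<u − #closers<u` of the inflated word equals
`Σ_{i < min(vrank u, 2jE)} ±[preLetter i] + Σ_{i < vrank u − 2jE} ±[i < tailPushes] − #(R ∩ [0,u))`
(`±[b] = 1` if `b` else `−1`): non-defect positions contribute their letters in V-rank order, defects pop.
[folklore] -/
theorem height_eq (u : ℕ) (hu : u ≤ N) :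
    (((openerSet (inflateWord R L m y)).filter fun i => i.val < u).card : ℤ)
        - (((closerSet (inflateWord R L m y)).filter fun i => i.val < u).card : ℤ)
      = (∑ i ∈ range (min (vrank R u) (2 * tailPairs R L m)),
            (if preLetter R L m y i = true then (1 : ℤ) else -1))
        + (∑ i ∈ range (vrank R u - 2 * tailPairs R L m),
            (if i < tailPushes R L m y then (1 : ℤ) else -1))
        - ((R.filter fun i : Fin N => i.val < u).card : ℤ) := by
  induction u with
  | zero =>
    simp only [card_filter_lt_zero, Nat.cast_zero, sub_zero]
    rw [show vrank R 0 = 0 from le_antisymm (vrank_le R 0) (Nat.zero_le _)]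
    simp
  | succ u ih =>
    have hu' : u < N := hu
    have ih' := ih hu'.le
    set W := inflateWord R L m y with hW
    set uF : Fin N := ⟨u, hu'⟩ with huF
    rw [card_filter_lt_succ_nat (openerSet W) u, card_filter_lt_succ_nat (closerSet W) u,
      card_filter_lt_succ_nat R u, dif_pos hu', dif_pos hu', dif_pos hu']
    have hvr : vrank R (u + 1) = vrank R u + (if uF ∈ R then 0 else 1) := vrank_succ R uF
    by_cases huR : uF ∈ R
    · -- a defect: pops
      have hWu : W uF = false := inflateWord_apply_of_mem R L m y huR
      rw [if_neg (by rw [mem_openerSet, hWu]; exact Bool.false_ne_true), if_pos (mem_closerSet.2 hWu),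
        if_pos huR, hvr, if_pos huR]
      simp only [add_zero]
      push_cast
      linarith
    · rw [if_neg huR, hvr, if_neg huR]
      by_cases hlt : vrank R u < 2 * tailPairs R L m
      · -- head / middle letter
        have hWu : W uF = preLetter R L m y (vrank R u) := inflateWord_apply_of_lt R L m y huR hlt
        have hmin : min (vrank R u + 1) (2 * tailPairs R L m) = min (vrank R u) (2 * tailPairs R L m) + 1 := by
          rw [min_eq_left (by omega), min_eq_left hlt.le]
        have htl : vrank R u + 1 - 2 * tailPairs R L m = vrank R u - 2 * tailPairs R L m := by omega
        rw [hmin, sum_range_succ, htl, min_eq_left hlt.le]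
        rw [min_eq_left hlt.le] at ih'
        by_cases hb : preLetter R L m y (vrank R u) = true
        · rw [if_pos (by rw [mem_openerSet, hWu, hb]), if_neg (by rw [mem_closerSet, hWu, hb]; decide),
            if_pos hb]
          push_cast; linarith
        · rw [if_neg (by rw [mem_openerSet, hWu]; exact hb), if_pos (by rw [mem_closerSet, hWu]; exact Bool.eq_false_iff.2 hb),
            if_neg hb]
          push_cast; linarith
      · -- tail letter
        rw [not_lt] at hlt
        have hWu : W uF = decide (vrank R u - 2 * tailPairs R L m < tailPushes R L m y) :=
          inflateWord_apply_of_le R L m y huR hlt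
        have hmin : min (vrank R u + 1) (2 * tailPairs R L m) = min (vrank R u) (2 * tailPairs R L m) := by
          rw [min_eq_right (by omega), min_eq_right hlt]
        have htl : vrank R u + 1 - 2 * tailPairs R L m = (vrank R u - 2 * tailPairs R L m) + 1 := by omega
        rw [hmin, htl, sum_range_succ]
        by_cases hb : vrank R u - 2 * tailPairs R L m < tailPushes R L m y
        · have hWu' : W uF = true := by rw [hWu, decide_eq_true hb]
          rw [if_pos (mem_openerSet.2 hWu'), if_neg (by rw [mem_closerSet, hWu']; decide),
            if_pos hb]
          push_cast; linarith
        · have hWu' : W uF = false := by rw [hWu, decide_eq_false hb]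
          rw [if_neg (by rw [mem_openerSet, hWu']; exact Bool.false_ne_true), if_pos (mem_closerSet.2 hWu'),
            if_neg hb]
          push_cast; linarith

/-! ### Sums over pairs -/

/-- A sum over `2t` indices is the sum over `t` pairs. [folklore] -/
theorem sum_range_two_mul {α : Type*} [AddCommMonoid α] (f : ℕ → α) (t : ℕ) :
    ∑ i ∈ range (2 * t), f i = ∑ j ∈ range t, (f (2 * j) + f (2 * j + 1)) := by
  induction t with
  | zero => simp
  | succ t ih =>
    rw [show 2 * (t + 1) = 2 * t + 1 + 1 by ring, sum_range_succ, sum_range_succ, ih, sum_range_succ,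
      add_assoc]

/-- **The letters before pair `t` (`jA ≤ t`)**: `2·jA` head pushes, then the decoded pairs `jA ≤ j < t`. [folklore] -/
theorem sum_preLetter_eq (t : ℕ) (ht : headPairs R L m ≤ t) :
    (∑ i ∈ range (2 * t), (if preLetter R L m y i = true then (1 : ℤ) else -1))
      = 2 * (headPairs R L m : ℤ) + ∑ j ∈ Ico (headPairs R L m) t,
          ((if (decodePair (isInflate R L m j)
                (if h : 2 * j < 2 * (Rᶜ.card / 2) then y ⟨2 * j, h⟩ else false)
                (if h : 2 * j + 1 < 2 * (Rᶜ.card / 2) then y ⟨2 * j + 1, h⟩ else false)).1 = true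
             then (1 : ℤ) else -1)
          + (if (decodePair (isInflate R L m j)
                (if h : 2 * j < 2 * (Rᶜ.card / 2) then y ⟨2 * j, h⟩ else false)
                (if h : 2 * j + 1 < 2 * (Rᶜ.card / 2) then y ⟨2 * j + 1, h⟩ else false)).2 = true
             then (1 : ℤ) else -1)) := by
  rw [sum_range_two_mul, ← Finset.sum_range_add_sum_Ico _ ht]
  congr 1
  · -- head pairs: both letters push
    have h2 : ∀ j ∈ range (headPairs R L m),
        ((if preLetter R L m y (2 * j) = true then (1 : ℤ) else -1)
          + (if preLetter R L m y (2 * j + 1) = true then (1 : ℤ) else -1)) = 2 := by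
      intro j hj
      rw [mem_range] at hj
      rw [preLetter_of_lt R L m y (by omega), preLetter_of_lt R L m y (by omega)]
      norm_num
    rw [sum_congr rfl h2, sum_const, card_range, nsmul_eq_mul]
    ring
  · refine Finset.sum_congr rfl fun j hj => ?_
    rw [mem_Ico] at hj
    rw [show 2 * j = 2 * j + 0 by ring, preLetter_mid R L m y (e := 0) (by norm_num) (by omega),
      show 2 * j + 0 + 1 = 2 * j + 1 by ring, preLetter_mid R L m y (e := 1) (by norm_num) (by omega)]
    simp

/-- **The height at a pair start.**  For `jA ≤ t ≤ jE`, at the position `u_t = vpos (2t)` of the `t`-th pair start,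
`height(u_t) = 2·jA + Σ_{jA ≤ j < t} (pair letter sum) − #(R ∩ [0, u_t))`. [folklore] -/
theorem height_pairStart (t : ℕ) (ht : headPairs R L m ≤ t) (htE : t ≤ tailPairs R L m) :
    (((openerSet (inflateWord R L m y)).filter fun i => i.val < vpos R (2 * t)).card : ℤ)
        - (((closerSet (inflateWord R L m y)).filter fun i => i.val < vpos R (2 * t)).card : ℤ)
      = 2 * (headPairs R L m : ℤ) + (∑ j ∈ Ico (headPairs R L m) t,
          ((if (decodePair (isInflate R L m j)
                (if h : 2 * j < 2 * (Rᶜ.card / 2) then y ⟨2 * j, h⟩ else false)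
                (if h : 2 * j + 1 < 2 * (Rᶜ.card / 2) then y ⟨2 * j + 1, h⟩ else false)).1 = true
             then (1 : ℤ) else -1)
          + (if (decodePair (isInflate R L m j)
                (if h : 2 * j < 2 * (Rᶜ.card / 2) then y ⟨2 * j, h⟩ else false)
                (if h : 2 * j + 1 < 2 * (Rᶜ.card / 2) then y ⟨2 * j + 1, h⟩ else false)).2 = true
             then (1 : ℤ) else -1)))
        - ((R.filter fun i : Fin N => i.val < vpos R (2 * t)).card : ℤ) := by
  have hvr : vrank R (vpos R (2 * t)) = 2 * t := by
    by_cases h : 2 * t < Rᶜ.card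
    · exact vrank_vpos R h
    · rw [vpos_of_le R (not_lt.1 h), vrank_of_le R le_rfl]
      have : 2 * tailPairs R L m ≤ Rᶜ.card := by unfold tailPairs; omega
      omega
  rw [height_eq R L m y _ (vpos_le R _), hvr, min_eq_left (by omega), Nat.sub_eq_zero_of_le (by omega),
    sum_range_zero, add_zero, sum_preLetter_eq R L m y t ht]

/-! ### The head (S4) -/

/-- `jA ≤ jE`. [folklore] -/
theorem headPairs_le : headPairs R L m ≤ tailPairs R L m := by
  unfold headPairs
  split_ifs with h
  · have hmem := Finset.min'_mem _ h
    rw [mem_filter, mem_range] at hmem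
    omega
  · exact le_rfl

/-- **The head stopping rule.**  If some `j ≤ jE` satisfies the head condition
`L + need (vpos 2j) + #(R ∩ [0, vpos 2j)) ≤ 2j` (the all-push height has reached the envelope), then `jA` is the
least such `j`. [folklore] -/
theorem headPairs_spec (hex : ∃ j, j ≤ tailPairs R L m ∧
      L + need R L m (vpos R (2 * j)) + (R.filter fun i : Fin N => (i : ℕ) < vpos R (2 * j)).card ≤ 2 * j) :
    L + need R L m (vpos R (2 * headPairs R L m))
        + (R.filter fun i : Fin N => (i : ℕ) < vpos R (2 * headPairs R L m)).card ≤ 2 * headPairs R L m ∧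
      ∀ j < headPairs R L m,
        ¬ (L + need R L m (vpos R (2 * j)) + (R.filter fun i : Fin N => (i : ℕ) < vpos R (2 * j)).card ≤ 2 * j) := by
  have hne : ((range (tailPairs R L m + 1)).filter fun j =>
      L + need R L m (vpos R (2 * j)) + (R.filter fun i : Fin N => (i : ℕ) < vpos R (2 * j)).card ≤ 2 * j).Nonempty := by
    obtain ⟨j, hj, hc⟩ := hex
    exact ⟨j, mem_filter.2 ⟨mem_range.2 (by omega), hc⟩⟩
  have hdef : headPairs R L m = ((range (tailPairs R L m + 1)).filter fun j =>
      L + need R L m (vpos R (2 * j)) + (R.filter fun i : Fin N => (i : ℕ) < vpos R (2 * j)).card ≤ 2 * j).min' hne := by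
    unfold headPairs; rw [dif_pos hne]
  constructor
  · have hmem := Finset.min'_mem _ hne
    rw [← hdef, mem_filter] at hmem
    exact hmem.2
  · intro j hj hc
    have hmemj : j ∈ ((range (tailPairs R L m + 1)).filter fun j =>
        L + need R L m (vpos R (2 * j)) + (R.filter fun i : Fin N => (i : ℕ) < vpos R (2 * j)).card ≤ 2 * j) :=
      mem_filter.2 ⟨mem_range.2 (by have := headPairs_le R L m; omega), hc⟩
    have hle := Finset.min'_le _ j hmemj
    rw [← hdef] at hle
    omega

/-! ### Inflation pair starts between two pair starts -/

/-- `2·jE ≤ #Rᶜ`. [folklore] -/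
theorem two_mul_tailPairs_le : 2 * tailPairs R L m ≤ Rᶜ.card := by
  unfold tailPairs; omega

/-- Monotonicity of `vpos` in the weak form, allowing the index `#Rᶜ` (position `N`). [folklore] -/
theorem vpos_le_vpos {i j : ℕ} (hij : i ≤ j) (hj : j ≤ Rᶜ.card) : vpos R i ≤ vpos R j := by
  rcases hij.eq_or_lt with rfl | hlt
  · exact le_rfl
  rcases hj.eq_or_lt with rfl | hj'
  · rw [vpos_of_le R le_rfl]; exact vpos_le R i
  · exact (vpos_lt_vpos R hlt hj').le

/-- **The inflation pair starts in `[vpos 2a, vpos 2b)` are the pairs `a ≤ j < b` with `isInflate j`.** [folklore] -/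
theorem card_inflStarts_eq (a b : ℕ) (hb : b ≤ tailPairs R L m) :
    ((univ : Finset (Fin N)).filter fun s : Fin N => vpos R (2 * a) ≤ (s : ℕ) ∧ (s : ℕ) < vpos R (2 * b) ∧
        s ∉ R ∧ vrank R s % 2 = 0 ∧ 0 < need R L m ((s : ℕ) + 1)).card
      = ((Ico a b).filter fun j => isInflate R L m j = true).card := by
  classical
  have h2b : 2 * b ≤ Rᶜ.card := le_trans (by omega) (two_mul_tailPairs_le R L m)
  symm
  refine Finset.card_bij (fun j hj => ⟨vpos R (2 * j), vpos_lt R (by rw [mem_filter, mem_Ico] at hj; omega)⟩)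
    (fun j hj => ?_) (fun j₁ hj₁ j₂ hj₂ h => ?_) (fun s hs => ?_)
  · rw [mem_filter, mem_Ico] at hj
    obtain ⟨⟨h1, h2⟩, h3⟩ := hj
    have hj2 : 2 * j < Rᶜ.card := by omega
    refine mem_filter.2 ⟨mem_univ _, vpos_le_vpos R (by omega) (by omega), ?_, vpos_not_mem R hj2, ?_, ?_⟩
    · show vpos R (2 * j) < vpos R (2 * b)
      rcases h2b.eq_or_lt with h | h
      · rw [vpos_of_le R h.ge]; exact vpos_lt R hj2
      · exact vpos_lt_vpos R (by omega) h
    · show vrank R (vpos R (2 * j)) % 2 = 0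
      rw [vrank_vpos R hj2]; omega
    · unfold isInflate at h3
      simpa using h3
  · simp only [Fin.mk.injEq] at h
    rw [mem_filter, mem_Ico] at hj₁ hj₂
    by_contra hne
    rcases Nat.lt_or_gt_of_ne hne with hlt | hlt
    · exact absurd h (ne_of_lt (vpos_lt_vpos R (by omega) (by omega)))
    · exact absurd h.symm (ne_of_lt (vpos_lt_vpos R (by omega) (by omega)))
  · rw [mem_filter] at hs
    obtain ⟨-, h1, h2, h3, h4, h5⟩ := hs
    refine ⟨vrank R s / 2, mem_filter.2 ⟨mem_Ico.2 ⟨?_, ?_⟩, ?_⟩, ?_⟩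
    · by_cases ha : 2 * a < Rᶜ.card
      · have := vrank_mono R h1
        rw [vrank_vpos R ha] at this
        omega
      · exfalso
        rw [vpos_of_le R (not_lt.1 ha)] at h1
        exact absurd s.isLt (not_lt.2 h1)
    · -- `s < vpos 2b` and `s ∉ R` ⇒ `vrank s + 1 ≤ 2b`
      have hstep := vrank_succ R s
      rw [if_neg h3] at hstep
      have hm := vrank_mono R (Nat.succ_le_of_lt h2)
      rw [hstep] at hm
      have : vrank R (vpos R (2 * b)) = 2 * b := by
        rcases h2b.eq_or_lt with h | h
        · rw [vpos_of_le R h.ge, vrank_of_le R le_rfl, h]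
        · exact vrank_vpos R h
      rw [this] at hm
      omega
    · have he : 2 * (vrank R s / 2) = vrank R s := by omega
      unfold isInflate
      rw [he, vpos_vrank R h3]
      simpa using h5
    · apply Fin.ext
      show vpos R (2 * (vrank R s / 2)) = s
      rw [show 2 * (vrank R s / 2) = vrank R s by omega, vpos_vrank R h3]

/-! ### The pair walk: height minus envelope between pair starts (SPEC S7) -/

/-- Splitting a window count at an intermediate point. [folklore] -/
theorem card_filter_Ico_split (s : Finset (Fin N)) {a b c : ℕ} (hab : a ≤ b) (hbc : b ≤ c) :
    (s.filter fun i : Fin N => a ≤ (i : ℕ) ∧ (i : ℕ) < c).card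
      = (s.filter fun i : Fin N => a ≤ (i : ℕ) ∧ (i : ℕ) < b).card
        + (s.filter fun i : Fin N => b ≤ (i : ℕ) ∧ (i : ℕ) < c).card := by
  rw [← card_union_of_disjoint]
  · congr 1
    ext i
    simp only [mem_filter, mem_union]
    constructor
    · rintro ⟨hi, h1, h2⟩
      by_cases h : (i : ℕ) < b
      · exact Or.inl ⟨hi, h1, h⟩
      · exact Or.inr ⟨hi, not_lt.1 h, h2⟩
    · rintro (⟨hi, h1, h2⟩ | ⟨hi, h1, h2⟩)
      · exact ⟨hi, h1, by omega⟩
      · exact ⟨hi, by omega, h2⟩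
  · rw [disjoint_filter]
    intro i _ h1 h2
    omega

/-- Prefix counts as window counts from `0`. [folklore] -/
theorem card_filter_lt_eq_Ico (s : Finset (Fin N)) (b : ℕ) :
    (s.filter fun i : Fin N => (i : ℕ) < b).card = (s.filter fun i : Fin N => 0 ≤ (i : ℕ) ∧ (i : ℕ) < b).card := by
  congr 1
  ext i
  simp only [mem_filter, zero_le, true_and]

/-- **The pair walk identity.**  For `jA ≤ t ≤ jE`, with `u_t = vpos (2t)` the `t`-th pair start and `u_A = vpos (2jA)`:
`(height(u_t) − need(u_t)) − (height(u_A) − need(u_A)) = Σ_{jA ≤ j < t} (pair letter sum_j − [isInflate j])`.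
Since the SPEC's envelope is `H = L + need`, this says `h − H` sampled at pair starts is, up to the constant
`h(u_A) − H(u_A)` (the head overshoot), the walk of the CENTRED pair steps (inflation: `+1` iff the two bits agree;
neutral: `±1 ± 1`) — the shape `…PairWalkBand.card_filter_pairWalk_exits_le` bounds. [folklore] -/
theorem height_sub_need_pairStart (t : ℕ) (ht : headPairs R L m ≤ t) (htE : t ≤ tailPairs R L m) :
    ((((openerSet (inflateWord R L m y)).filter fun i => i.val < vpos R (2 * t)).card : ℤ)
        - (((closerSet (inflateWord R L m y)).filter fun i => i.val < vpos R (2 * t)).card : ℤ)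
        - (need R L m (vpos R (2 * t)) : ℤ))
      - ((((openerSet (inflateWord R L m y)).filter fun i => i.val < vpos R (2 * headPairs R L m)).card : ℤ)
        - (((closerSet (inflateWord R L m y)).filter fun i => i.val < vpos R (2 * headPairs R L m)).card : ℤ)
        - (need R L m (vpos R (2 * headPairs R L m)) : ℤ))
      = ∑ j ∈ Ico (headPairs R L m) t,
          (((if (decodePair (isInflate R L m j)
                (if h : 2 * j < 2 * (Rᶜ.card / 2) then y ⟨2 * j, h⟩ else false)
                (if h : 2 * j + 1 < 2 * (Rᶜ.card / 2) then y ⟨2 * j + 1, h⟩ else false)).1 = true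
             then (1 : ℤ) else -1)
          + (if (decodePair (isInflate R L m j)
                (if h : 2 * j < 2 * (Rᶜ.card / 2) then y ⟨2 * j, h⟩ else false)
                (if h : 2 * j + 1 < 2 * (Rᶜ.card / 2) then y ⟨2 * j + 1, h⟩ else false)).2 = true
             then (1 : ℤ) else -1))
          - (if isInflate R L m j = true then (1 : ℤ) else 0)) := by
  classical
  have hAt : vpos R (2 * headPairs R L m) ≤ vpos R (2 * t) :=
    vpos_le_vpos R (by omega) (le_trans (by omega) (two_mul_tailPairs_le R L m))
  have htE' : vpos R (2 * t) ≤ tailStart R L m := by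
    unfold tailStart
    exact vpos_le_vpos R (by omega) (two_mul_tailPairs_le R L m)
  have hAE : vpos R (2 * headPairs R L m) ≤ tailStart R L m := hAt.trans htE'
  -- heights at the two pair starts
  rw [height_pairStart R L m y t ht htE, height_pairStart R L m y (headPairs R L m) le_rfl (headPairs_le R L m),
    Finset.Ico_self, sum_empty, add_zero]
  -- `need` at the two pair starts (closed form)
  have hnA := need_add_card_eq R L m (vpos R (2 * headPairs R L m)) hAE
  have hnt := need_add_card_eq R L m (vpos R (2 * t)) htE'
  -- split the windows `[uA, E)` at `ut`
  have sR := card_filter_Ico_split (N := N) R hAt htE'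
  have sI := card_filter_Ico_split (N := N)
    ((univ : Finset (Fin N)).filter fun s : Fin N => s ∉ R ∧ vrank R s % 2 = 0 ∧ 0 < need R L m ((s : ℕ) + 1))
    hAt htE'
  -- rewrite the inflation-start filters as filters of the fixed set
  have hI : ∀ a c : ℕ, ((univ : Finset (Fin N)).filter fun s : Fin N => a ≤ (s : ℕ) ∧ (s : ℕ) < c ∧ s ∉ R ∧
        vrank R s % 2 = 0 ∧ 0 < need R L m ((s : ℕ) + 1)).card
      = (((univ : Finset (Fin N)).filter fun s : Fin N => s ∉ R ∧ vrank R s % 2 = 0 ∧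
          0 < need R L m ((s : ℕ) + 1)).filter fun s : Fin N => a ≤ (s : ℕ) ∧ (s : ℕ) < c).card := by
    intro a c
    congr 1
    ext s
    simp only [mem_filter, mem_univ, true_and]
    tauto
  rw [hI] at hnA hnt
  -- the window `[uA, ut)` of inflation starts = inflate pairs in `[jA, t)`
  have hIw := card_inflStarts_eq R L m (headPairs R L m) t htE
  rw [hI] at hIw
  -- prefix counts of `R`
  have pA := card_filter_lt_eq_Ico (N := N) R (vpos R (2 * headPairs R L m))
  have pt := card_filter_lt_eq_Ico (N := N) R (vpos R (2 * t))
  have p0 := card_filter_Ico_split (N := N) R (Nat.zero_le (vpos R (2 * headPairs R L m))) hAt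
  -- the sum of the pair terms splits
  rw [Finset.sum_sub_distrib, Finset.sum_boole, ← hIw]
  omega

end Summit.ValiantsHypothesis.ValiantsHypothesis.Theorems.FifoMatching.NNLinearDegreeCofactorHard.InflateWord

end
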